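import Literature.Analysis.FluidPDE.CKNMorreyLocalEnergyStepsProofs
import Literature.Analysis.FluidPDE.CKNMorreyTestFunctionBound
import HarnessLib

/-!
# Discharges towards Lemarié-Rieusset 2016, Lemma 13.3 (`lemma13_3`)

Analysis/FluidPDE proofs file, sibling of `CKNMorreyLocalEnergy.lean` (the named fact
`Literature.Analysis.FluidPDE.LemarieRieusset2016.lemma13_3`, Lemarié-Rieusset 2016,
Lemma 13.3, (13.30)–(13.31), p. 470) and of `CKNMorreyLocalEnergySteps.lean` (its decomposition
into the printed steps of §13.9, Step 1, with the proved assembly `lemma13_3_of_steps`). It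
records what the proved steps leave of it. The discharges `estimate13_26_holds`,
`estimate13_27_holds` ((13.26), (13.27): `CKNMorreyLocalEnergyStepsProofs.lean`, from
`exists_secondTerm_le` and `exists_lintegral_mul_force_le`) and the test-function bound are in
the tree:

* the test-function bound of p. 467 is `LemarieRieusset2016.step1_testFunctionBound_holds`
  (`CKNMorreyTestFunctionBound.lean`: Scheffer's test function in the sliced local energy
  inequality);
* `LemarieRieusset2016.lemma13_3_energy_of_pressureTerm`, `lemma13_3_of_pressure` — what is
  left: (13.30) follows from the pressure term (13.28)–(13.29) (`step1_pressureTerm`) alone, and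
  `lemma13_3` from it and the pressure estimate (13.31) (`lemma13_3_pressure`); both remaining
  facts are the Newtonian splitting of the pressure with the Calderón–Zygmund bound
  (`stein1970_hessian_Lp_bound`).

It also records the discharge `cubicW_le_holds` of the named fact `cubicW_le`
(`cubicW_le_of_interpolationEstimate interpolationEstimate_holds`).

## References

* P. G. Lemarié-Rieusset, *The Navier–Stokes Problem in the 21st Century*, CRC Press (2016),
  §13.9 Step 1, pp. 467–470, (13.26), (13.27), Lemma 13.3. [LemarieRieusset2016]
-/

noncomputable section

open MeasureTheory Set Function Filter TopologicalSpace Metric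
open scoped NNReal ENNReal InnerProductSpace RealInnerProductSpace

namespace Literature.Analysis.FluidPDE

namespace LemarieRieusset2016

/-- **(13.30) from the pressure term alone**: with the test-function bound, (13.25), (13.26),
(13.27) and the summary proved, the energy half (13.30) of Lemma 13.3 follows from the
pressure term (13.28)–(13.29). [cite: LemarieRieusset2016, Lemma 13.3 (13.30) p. 470] -/
theorem lemma13_3_energy_of_pressureTerm (hP : step1_pressureTerm) : lemma13_3_energy :=
  lemma13_3_energy_of_steps step1_testFunctionBound_holds estimate13_26_holds
    estimate13_27_holds hP

/-- **Lemma 13.3 from its pressure estimates**: `lemma13_3` follows from the pressure term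
(13.28)–(13.29) and the pressure estimate (13.31) (everything else being proved). [cite: LemarieRieusset2016, Lemma 13.3 p. 470] -/
theorem lemma13_3_of_pressure (hP : step1_pressureTerm) (h31 : lemma13_3_pressure) : lemma13_3 :=
  lemma13_3_of_steps step1_testFunctionBound_holds estimate13_26_holds estimate13_27_holds hP h31

/-- **Discharge of `cubicW_le`** (`W_r ≤ C r^{1/2} (U_r + V_r)^{3/2}`, Lemarié-Rieusset 2016,
p. 468 and p. 471): the derivation `cubicW_le_of_interpolationEstimate` of
`CKNMorreyLocalEnergy.lean` fed with the proved interpolation inequality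
`interpolationEstimate_holds` (Robinson–Rodrigo–Sadowski 2016, Lemma 15.10). (Restores the
declaration of this name that an earlier whole-file resubmission of this module dropped.) [cite: LemarieRieusset2016, §13.9 p. 468 and p. 471] -/
theorem cubicW_le_holds : cubicW_le :=
  cubicW_le_of_interpolationEstimate interpolationEstimate_holds

end LemarieRieusset2016

end Literature.Analysis.FluidPDE
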